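import Summits.Ventures.PercRepro.GenQChargeTwo

/-!
# PercRepro — fundamental circuits and the supersets `B₀ ∪ {x}`, `B₀ ∪ {x, y}` of a basis (night-4, gen 3;
sheet §48, L2–L3)

For the type-`2` window through the charging form (`GenQChargeTwo.lean`): the bases inside a superset of a basis `B₀`
of a rank-`q` flat `G` and the coloops of that superset are controlled by the fundamental circuits of the added points.

* `fc M x B` — the fundamental circuit `M.fundCircuit x ↑B` as a finset (`⊆ insert x B`);
* `three_le_card_fc` — in a simple matroid a fundamental circuit has at least `3` points;
* `nb_insert_le` — the bases inside `B₀ ∪ {x}` are `B₀ ∪ {x} ∖ {y}` for `y` in the circuit: `nb ≤ #C`;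
* `mTr_insert_add_card_fc_le` — the coloops of `B₀ ∪ {x}` avoid the circuit: `m + #C ≤ q + 1`;
* `mTr_pair_le`, `nb_pair_le` — the same for `B₀ ∪ {x, y}` with the two circuits `C`, `D`:
  `m + #(C ∪ D) ≤ q + 2` and `nb + #{T ⊇ C} + #{T ⊇ D} ≤ C(q+2, q) + 1` when `#(C ∪ D) ≥ q`.
-/

namespace PercRepro.GenQ

open Finset ThmH PerFlat SixFour ThmN

variable {α : Type*} [DecidableEq α] {M : Matroid α} [M.Finite]

/-! ## Bases of a flat -/

omit [DecidableEq α] in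
/-- Membership in `basesOf`. -/
theorem mem_basesOf {G B : Finset α} {q : ℕ} :
    B ∈ basesOf M G q ↔ B ⊆ G ∧ M.eRk (B : Set α) = (q : ℕ∞) ∧ B.card = q := by
  unfold basesOf
  rw [Finset.mem_filter, mem_Rq, and_assoc]

omit [DecidableEq α] in
/-- A basis of `G` is independent. -/
theorem indep_of_mem_basesOf {G B : Finset α} {q : ℕ} (hB : B ∈ basesOf M G q) : M.Indep (B : Set α) := by
  obtain ⟨_, hr, hc⟩ := mem_basesOf.1 hB
  rw [Matroid.indep_iff_eRk_eq_encard_of_finite (Finset.finite_toSet B), hr, Set.encard_coe_eq_coe_finsetCard, hc]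

omit [DecidableEq α] in
/-- A rank-`q` subset of `G` with `q` points is independent. -/
theorem indep_of_card_eq_of_mem_Rq {G B : Finset α} {q : ℕ} (hB : B ∈ Rq M G q) (hc : B.card = q) :
    M.Indep (B : Set α) :=
  indep_of_mem_basesOf (mem_basesOf.2 ⟨(mem_Rq.1 hB).1, (mem_Rq.1 hB).2, hc⟩)

omit [DecidableEq α] in
/-- A spanning non-basis is dependent. -/
theorem not_indep_of_card_ne_of_mem_Rq {G B : Finset α} {q : ℕ} (hB : B ∈ Rq M G q) (hc : B.card ≠ q) :
    ¬ M.Indep (B : Set α) := by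
  intro hI
  have h := hI.eRk_eq_encard
  rw [(mem_Rq.1 hB).2, Set.encard_coe_eq_coe_finsetCard] at h
  exact hc (by exact_mod_cast h.symm)

omit [DecidableEq α] in
/-- Every point of `G` lies in the closure of a basis of `G`. -/
theorem mem_closure_of_mem_basesOf {G B : Finset α} {q : ℕ} (hG : G ⊆ gr M)
    (hrG : M.eRk (G : Set α) = (q : ℕ∞)) (hB : B ∈ basesOf M G q) {x : α} (hx : x ∈ G) :
    x ∈ M.closure (B : Set α) := by
  obtain ⟨hBG, hr, _⟩ := mem_basesOf.1 hB
  have hcl : M.closure (B : Set α) = M.closure (G : Set α) :=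
    (M.isRkFinite_of_finite (Finset.finite_toSet B)).closure_eq_closure_of_subset_of_eRk_ge_eRk
      (by exact_mod_cast hBG) (by rw [hrG, hr])
  rw [hcl]
  exact M.subset_closure _ (by rw [← coe_gr M]; exact_mod_cast hG) (Finset.mem_coe.2 hx)

/-! ## The fundamental circuit as a finset -/

omit [M.Finite] in
/-- `fundCircuit x B ⊆ insert x B` (as sets of a finset). -/
theorem fundCircuit_subset_coe_insert (M : Matroid α) (x : α) (B : Finset α) :
    M.fundCircuit x (B : Set α) ⊆ ((insert x B : Finset α) : Set α) := by
  rw [Finset.coe_insert]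
  exact M.fundCircuit_subset_insert x (B : Set α)

omit [M.Finite] in
/-- The fundamental circuit of a finset is finite. -/
theorem fundCircuit_finite (M : Matroid α) (x : α) (B : Finset α) : (M.fundCircuit x (B : Set α)).Finite :=
  (Finset.finite_toSet (insert x B)).subset (fundCircuit_subset_coe_insert M x B)

/-- The fundamental circuit `M.fundCircuit x ↑B` as a finset. -/
noncomputable def fc (M : Matroid α) (x : α) (B : Finset α) : Finset α := (fundCircuit_finite M x B).toFinset

omit [M.Finite] in
/-- Membership in `fc`. -/
theorem mem_fc {x e : α} {B : Finset α} : e ∈ fc M x B ↔ e ∈ M.fundCircuit x (B : Set α) := by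
  unfold fc
  exact Set.Finite.mem_toFinset _

omit [M.Finite] in
/-- `↑(fc M x B) = M.fundCircuit x ↑B`. -/
theorem coe_fc (x : α) (B : Finset α) : ((fc M x B : Finset α) : Set α) = M.fundCircuit x (B : Set α) := by
  unfold fc
  exact Set.Finite.coe_toFinset _

omit [M.Finite] in
/-- `fc M x B ⊆ insert x B`. -/
theorem fc_subset_insert (x : α) (B : Finset α) : fc M x B ⊆ insert x B := by
  intro e he
  rw [mem_fc] at he
  exact Finset.mem_coe.1 (fundCircuit_subset_coe_insert M x B he)

omit [M.Finite] in
/-- `x ∈ fc M x B`. -/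
theorem mem_fc_self (x : α) (B : Finset α) : x ∈ fc M x B := mem_fc.2 (M.mem_fundCircuit x _)

omit [M.Finite] in
/-- `fc M x B` is a circuit when `B` is independent and `x ∈ cl(B) ∖ B`. -/
theorem isCircuit_fc {x : α} {B : Finset α} (hI : M.Indep (B : Set α)) (hx : x ∈ M.closure (B : Set α))
    (hxB : x ∉ B) : M.IsCircuit ((fc M x B : Finset α) : Set α) := by
  rw [coe_fc]
  exact hI.fundCircuit_isCircuit hx (by exact_mod_cast hxB)

omit [M.Finite] in
/-- `#(fc M x B) ≤ #B + 1`. -/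
theorem card_fc_le (x : α) (B : Finset α) : (fc M x B).card ≤ B.card + 1 :=
  (Finset.card_le_card (fc_subset_insert x B)).trans (Finset.card_insert_le x B)

/-- **In a simple matroid a fundamental circuit has at least three points** (`B` independent with `≥ 1` point,
`x ∈ cl(B) ∖ B`). -/
theorem three_le_card_fc (hs : Simple M) {x : α} {B : Finset α} (hB : B ⊆ gr M) (hxg : x ∈ gr M)
    (hI : M.Indep (B : Set α)) (hx : x ∈ M.closure (B : Set α)) (hxB : x ∉ B) (hne : B.Nonempty) :
    3 ≤ (fc M x B).card := by
  have hC : M.IsCircuit ((fc M x B : Finset α) : Set α) := isCircuit_fc hI hx hxB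
  have hrk : M.eRk ((fc M x B : Finset α) : Set α) + 1 = ((fc M x B).card : ℕ∞) := by
    rw [← Set.encard_coe_eq_coe_finsetCard]
    exact hC.eRk_add_one_eq
  have hE : ((insert x B : Finset α) : Set α) ⊆ M.E := by
    rw [← coe_gr M]
    exact_mod_cast Finset.insert_subset hxg hB
  by_contra hlt
  push Not at hlt
  have hpos : 1 ≤ (fc M x B).card := Finset.card_pos.2 ⟨x, mem_fc_self x B⟩
  rcases (show (fc M x B).card = 1 ∨ (fc M x B).card = 2 by omega) with h1 | h2
  · -- a loop: `fc = {x}`, so `eRk {x} = 0` and a second point `g` gives `eRk {x, g} ≤ 1`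
    obtain ⟨a, ha⟩ := Finset.card_eq_one.1 h1
    have hax : a = x := by
      have := mem_fc_self (M := M) x B
      rw [ha, Finset.mem_singleton] at this
      exact this.symm
    subst hax
    rw [h1] at hrk
    rw [ha, Finset.coe_singleton] at hrk
    obtain ⟨g, hg⟩ := hne
    have hgx : g ≠ a := fun h => hxB (h ▸ hg)
    have hgE : g ∈ M.E := hE (Finset.mem_coe.2 (Finset.mem_insert_of_mem hg))
    have haE : a ∈ M.E := hE (Finset.mem_coe.2 (Finset.mem_insert_self a B))
    have h2 := hs a haE g hgE (Ne.symm hgx)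
    have hle : M.eRk ({a, g} : Set α) ≤ M.eRk ({a} : Set α) + 1 := by
      rw [Set.pair_comm]
      exact M.eRk_insert_le_add_one g {a}
    rw [h2, hrk] at hle
    norm_num at hle
  · -- a parallel pair: `fc = {a, b}` has rank `1`, against simplicity
    obtain ⟨a, b, hab, hC'⟩ := Finset.card_eq_two.1 h2
    have haE : a ∈ M.E := hE (Finset.mem_coe.2 (fc_subset_insert x B (by rw [hC']; simp)))
    have hbE : b ∈ M.E := hE (Finset.mem_coe.2 (fc_subset_insert x B (by rw [hC']; simp)))
    have h2' := hs a haE b hbE hab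
    rw [h2] at hrk
    rw [hC', Finset.coe_pair, h2'] at hrk
    norm_num at hrk

/-! ## The singletons `B₀ ∪ {x}` -/

omit [DecidableEq α] in
/-- A set between a basis of `G` and `G` has rank `q`. -/
theorem eRk_eq_of_basesOf_subset {G B₀ S : Finset α} {q : ℕ} (hrG : M.eRk (G : Set α) = (q : ℕ∞))
    (hB : B₀ ∈ basesOf M G q) (hBS : B₀ ⊆ S) (hSG : S ⊆ G) : M.eRk (S : Set α) = (q : ℕ∞) := by
  obtain ⟨_, hr, _⟩ := mem_basesOf.1 hB
  have h1 : M.eRk (S : Set α) ≤ M.eRk (G : Set α) := M.eRk_mono (by exact_mod_cast hSG)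
  have h2 : M.eRk (B₀ : Set α) ≤ M.eRk (S : Set α) := M.eRk_mono (by exact_mod_cast hBS)
  rw [hrG] at h1
  rw [hr] at h2
  exact le_antisymm h1 h2

/-- `B₀ ∪ {x}` is a spanning set of `G` for a basis `B₀` of `G` and `x ∈ G`. -/
theorem insert_mem_Rq {G B₀ : Finset α} {q : ℕ} (hrG : M.eRk (G : Set α) = (q : ℕ∞)) (hB : B₀ ∈ basesOf M G q)
    {x : α} (hx : x ∈ G) : insert x B₀ ∈ Rq M G q := by
  have hBG := (mem_basesOf.1 hB).1
  exact mem_Rq.2 ⟨Finset.insert_subset hx hBG,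
    eRk_eq_of_basesOf_subset hrG hB (Finset.subset_insert x B₀) (Finset.insert_subset hx hBG)⟩

/-- **The bases inside `B₀ ∪ {x}`** are the sets `B₀ ∪ {x} ∖ {y}` with `y` in the fundamental circuit of `x`:
`nb(B₀ ∪ {x}) ≤ #C`. -/
theorem nb_insert_le {G B₀ : Finset α} {q : ℕ} (hG : G ⊆ gr M) (hrG : M.eRk (G : Set α) = (q : ℕ∞))
    (hB : B₀ ∈ basesOf M G q) {x : α} (hx : x ∈ G) (hxB : x ∉ B₀) :
    nb M G (insert x B₀) q ≤ (fc M x B₀).card := by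
  have hI := indep_of_mem_basesOf hB
  have hxcl := mem_closure_of_mem_basesOf hG hrG hB hx
  obtain ⟨_, _, hc⟩ := mem_basesOf.1 hB
  unfold nb
  have hsub : (basesOf M G q).filter (fun B' => B' ⊆ insert x B₀) ⊆
      (fc M x B₀).image (fun y => (insert x B₀).erase y) := by
    intro B' hB'
    rw [Finset.mem_filter] at hB'
    obtain ⟨hB'b, hB'sub⟩ := hB'
    obtain ⟨_, _, hc'⟩ := mem_basesOf.1 hB'b
    have hcard : B'.card < (insert x B₀).card := by
      rw [Finset.card_insert_of_notMem hxB]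
      omega
    obtain ⟨y, hyS, hyB'⟩ := Finset.exists_mem_notMem_of_card_lt_card hcard
    have hB'eq : B' = (insert x B₀).erase y := by
      apply Finset.eq_of_subset_of_card_le
      · intro z hz
        exact Finset.mem_erase.2 ⟨fun h => hyB' (h ▸ hz), hB'sub hz⟩
      · rw [Finset.card_erase_of_mem hyS, Finset.card_insert_of_notMem hxB]
        omega
    rw [Finset.mem_image]
    refine ⟨y, ?_, hB'eq.symm⟩
    rw [mem_fc, hI.mem_fundCircuit_iff hxcl (by exact_mod_cast hxB)]
    have hset : (insert x (B₀ : Set α)) \ {y} = (((insert x B₀).erase y : Finset α) : Set α) := by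
      rw [Finset.coe_erase, Finset.coe_insert]
    rw [hset, ← hB'eq]
    exact indep_of_mem_basesOf hB'b
  exact (Finset.card_le_card hsub).trans Finset.card_image_le

/-- **The coloops of `B₀ ∪ {x}` avoid the fundamental circuit**: `m(B₀ ∪ {x}) + #C ≤ q + 1`. -/
theorem mTr_insert_add_card_fc_le {G B₀ : Finset α} {q : ℕ} (hG : G ⊆ gr M) (hrG : M.eRk (G : Set α) = (q : ℕ∞))
    (hB : B₀ ∈ basesOf M G q) {x : α} (hx : x ∈ G) (hxB : x ∉ B₀) :
    mTr M (insert x B₀) + (fc M x B₀).card ≤ q + 1 := by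
  have hI := indep_of_mem_basesOf hB
  have hxcl := mem_closure_of_mem_basesOf hG hrG hB hx
  obtain ⟨_, _, hc⟩ := mem_basesOf.1 hB
  have hC : M.IsCircuit ((fc M x B₀ : Finset α) : Set α) := isCircuit_fc hI hxcl hxB
  have hsub : coloopsOf M (insert x B₀) ⊆ (insert x B₀) \ fc M x B₀ := by
    intro e he
    rw [Finset.mem_sdiff]
    refine ⟨(mem_coloopsOf.1 he).1, fun heC => ?_⟩
    exact notMem_coloopsOf_of_mem_isCircuit hC (Finset.coe_subset.2 (fc_subset_insert x B₀))
      (Finset.mem_coe.2 heC) he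
  have h := Finset.card_le_card hsub
  rw [Finset.card_sdiff_of_subset (fc_subset_insert x B₀), Finset.card_insert_of_notMem hxB, hc] at h
  have h' := card_fc_le (M := M) x B₀
  rw [hc] at h'
  unfold mTr
  omega

/-! ## The pairs `B₀ ∪ {x, y}` -/

/-- `B₀ ∪ {x, y}` is a spanning set of `G`. -/
theorem pair_mem_Rq {G B₀ : Finset α} {q : ℕ} (hrG : M.eRk (G : Set α) = (q : ℕ∞))
    (hB : B₀ ∈ basesOf M G q) {x y : α} (hx : x ∈ G) (hy : y ∈ G) : insert x (insert y B₀) ∈ Rq M G q := by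
  have hBG := (mem_basesOf.1 hB).1
  have hsub : insert x (insert y B₀) ⊆ G := Finset.insert_subset hx (Finset.insert_subset hy hBG)
  exact mem_Rq.2 ⟨hsub, eRk_eq_of_basesOf_subset hrG hB
    ((Finset.subset_insert y B₀).trans (Finset.subset_insert x _)) hsub⟩

/-- **The coloops of `B₀ ∪ {x, y}` avoid both fundamental circuits**: `m + #(C ∪ D) ≤ q + 2`. -/
theorem mTr_pair_le {G B₀ : Finset α} {q : ℕ} (hG : G ⊆ gr M) (hrG : M.eRk (G : Set α) = (q : ℕ∞))
    (hB : B₀ ∈ basesOf M G q) {x y : α} (hx : x ∈ G) (hxB : x ∉ B₀) (hy : y ∈ G) (hyB : y ∉ B₀) (hxy : x ≠ y) :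
    mTr M (insert x (insert y B₀)) + (fc M x B₀ ∪ fc M y B₀).card ≤ q + 2 := by
  have hI := indep_of_mem_basesOf hB
  obtain ⟨_, _, hc⟩ := mem_basesOf.1 hB
  have hCx : M.IsCircuit ((fc M x B₀ : Finset α) : Set α) :=
    isCircuit_fc hI (mem_closure_of_mem_basesOf hG hrG hB hx) hxB
  have hCy : M.IsCircuit ((fc M y B₀ : Finset α) : Set α) :=
    isCircuit_fc hI (mem_closure_of_mem_basesOf hG hrG hB hy) hyB
  have hCxS : fc M x B₀ ⊆ insert x (insert y B₀) :=
    (fc_subset_insert x B₀).trans (Finset.insert_subset_insert x (Finset.subset_insert y B₀))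
  have hCyS : fc M y B₀ ⊆ insert x (insert y B₀) :=
    (fc_subset_insert y B₀).trans (Finset.subset_insert x _)
  have hsub : coloopsOf M (insert x (insert y B₀)) ⊆ (insert x (insert y B₀)) \ (fc M x B₀ ∪ fc M y B₀) := by
    intro e he
    rw [Finset.mem_sdiff]
    refine ⟨(mem_coloopsOf.1 he).1, fun heU => ?_⟩
    rcases Finset.mem_union.1 heU with heC | heD
    · exact notMem_coloopsOf_of_mem_isCircuit hCx (Finset.coe_subset.2 hCxS) (Finset.mem_coe.2 heC) he
    · exact notMem_coloopsOf_of_mem_isCircuit hCy (Finset.coe_subset.2 hCyS) (Finset.mem_coe.2 heD) he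
  have h := Finset.card_le_card hsub
  have hxS : x ∉ insert y B₀ := fun h' => by
    rcases Finset.mem_insert.1 h' with h'' | h''
    · exact hxy h''
    · exact hxB h''
  have hcardS : (insert x (insert y B₀)).card = q + 2 := by
    rw [Finset.card_insert_of_notMem hxS, Finset.card_insert_of_notMem hyB, hc]
  rw [Finset.card_sdiff_of_subset (Finset.union_subset hCxS hCyS), hcardS] at h
  have h' := Finset.card_le_card (Finset.union_subset hCxS hCyS)
  rw [hcardS] at h'
  unfold mTr
  omega

/-- **The bases inside `B₀ ∪ {x, y}`** avoid the `q`-subsets containing `C` or `D`: with `#(C ∪ D) ≥ q`,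
`nb + #{T ⊇ C} + #{T ⊇ D} ≤ C(q + 2, q) + 1` (`T` ranging over the `q`-subsets of `B₀ ∪ {x, y}`). -/
theorem nb_pair_le {G B₀ : Finset α} {q : ℕ} (hG : G ⊆ gr M) (hrG : M.eRk (G : Set α) = (q : ℕ∞))
    (hB : B₀ ∈ basesOf M G q) {x y : α} (hx : x ∈ G) (hxB : x ∉ B₀) (hy : y ∈ G) (hyB : y ∉ B₀) (hxy : x ≠ y)
    (hU : q ≤ (fc M x B₀ ∪ fc M y B₀).card) :
    nb M G (insert x (insert y B₀)) q +
      (((insert x (insert y B₀)).powersetCard q).filter (fun T => fc M x B₀ ⊆ T)).card +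
      (((insert x (insert y B₀)).powersetCard q).filter (fun T => fc M y B₀ ⊆ T)).card ≤
      (q + 2).choose q + 1 := by
  classical
  set S := insert x (insert y B₀) with hSdef
  have hI := indep_of_mem_basesOf hB
  obtain ⟨_, _, hc⟩ := mem_basesOf.1 hB
  have hCx : M.IsCircuit ((fc M x B₀ : Finset α) : Set α) :=
    isCircuit_fc hI (mem_closure_of_mem_basesOf hG hrG hB hx) hxB
  have hCy : M.IsCircuit ((fc M y B₀ : Finset α) : Set α) :=
    isCircuit_fc hI (mem_closure_of_mem_basesOf hG hrG hB hy) hyB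
  have hxS : x ∉ insert y B₀ := fun h' => by
    rcases Finset.mem_insert.1 h' with h'' | h''
    · exact hxy h''
    · exact hxB h''
  have hcardS : S.card = q + 2 := by
    rw [hSdef, Finset.card_insert_of_notMem hxS, Finset.card_insert_of_notMem hyB, hc]
  set P := S.powersetCard q with hPdef
  have hP : P.card = (q + 2).choose q := by rw [hPdef, Finset.card_powersetCard, hcardS]
  set A := P.filter (fun T => fc M x B₀ ⊆ T) with hAdef
  set D := P.filter (fun T => fc M y B₀ ⊆ T) with hDdef
  -- the bases inside `S` are independent `q`-subsets of `S`
  have h1 : nb M G S q ≤ (P.filter (fun T => M.Indep ((T : Finset α) : Set α))).card := by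
    unfold nb
    apply Finset.card_le_card
    intro B' hB'
    rw [Finset.mem_filter] at hB' ⊢
    obtain ⟨_, _, hc'⟩ := mem_basesOf.1 hB'.1
    exact ⟨Finset.mem_powersetCard.2 ⟨hB'.2, hc'⟩, indep_of_mem_basesOf hB'.1⟩
  -- the `q`-subsets containing a circuit are dependent
  have h2 : A ∪ D ⊆ P.filter (fun T => ¬ M.Indep ((T : Finset α) : Set α)) := by
    intro T hT
    rw [Finset.mem_filter]
    rcases Finset.mem_union.1 hT with hTA | hTD
    · rw [hAdef, Finset.mem_filter] at hTA
      exact ⟨hTA.1, fun hind => hCx.not_indep (hind.subset (Finset.coe_subset.2 hTA.2))⟩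
    · rw [hDdef, Finset.mem_filter] at hTD
      exact ⟨hTD.1, fun hind => hCy.not_indep (hind.subset (Finset.coe_subset.2 hTD.2))⟩
  have h3 := Finset.card_le_card h2
  have h4 := Finset.card_filter_add_card_filter_not (s := P) (fun T => M.Indep ((T : Finset α) : Set α))
  have h5 := Finset.card_union_add_card_inter A D
  -- at most one `q`-subset contains `C ∪ D`
  have h6 : (A ∩ D).card ≤ 1 := by
    rw [Finset.card_le_one]
    have key : ∀ T ∈ A ∩ D, T = fc M x B₀ ∪ fc M y B₀ := by
      intro T hT
      rw [Finset.mem_inter, hAdef, hDdef, Finset.mem_filter, Finset.mem_filter] at hT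
      have hTcard : T.card = q := (Finset.mem_powersetCard.1 hT.1.1).2
      exact (Finset.eq_of_subset_of_card_le (Finset.union_subset hT.1.2 hT.2.2) (by rw [hTcard]; exact hU)).symm
    intro T₁ hT₁ T₂ hT₂
    rw [key T₁ hT₁, key T₂ hT₂]
  omega

end PercRepro.GenQ
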